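/-
Copyright (c) 2026. All rights reserved.
Released under Apache 2.0 license as described in the file LICENSE.
Authors: HodgeCM publication cell (pub-hodgecm), GR lane, seat own-crow (`pub-hodgecm-own-crow`, third hand);
sequel to GR-2's `QuadExtPlacesAbove` (`pub-hodgecm-own-hyp34`).
-/
import Literature.NumberTheory.Automorphic.QuadExtPlacesAbove
import HarnessLib

/-!
# The place types of a quadratic extension `E/F` are intrinsic: the dichotomy at a real place (sequel to `QuadExtPlacesAbove`)

Topic `NumberTheory/Automorphic`; namespace `Literature.NumberTheory.Automorphic.UnitaryGroup`.  KERNEL ONLY: one definition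
with body (an index equivalence) and theorems; no `def … : Prop` record, no axiom, no proof hole.

`QuadExtPlacesAbove` chooses a place `placeAbove F E v` of `E` above every archimedean place `v` of `F` (general quadratic
`E/F`, Galois involution `c`) and calls a real `v` TYPE (i) (`IsTypeOne F E v`) when the CHOSEN place is complex, type (ii)
when it is real.  This file proves that the type does not depend on the choice and describes the whole fibre:

* §1 the dichotomy at a real place `v` of `F`, in Mathlib's intrinsic language (`InfinitePlace.IsUnramifiedIn`): if `v` is
  NOT unramified in `E`, EVERY place above `v` is complex and there is exactly ONE (`isComplex_of_comap_eq_of_not_isUnramifiedIn`,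
  `eq_of_comap_eq_of_not_isUnramifiedIn`); if `v` IS unramified in `E`, every place above `v` is real, and the fibre is
  `{w, c • w}` with `c • w ≠ w` (`isReal_of_comap_eq_of_isUnramifiedIn`, `eq_or_eq_smul_of_comap_eq`, `smul_ne_of_isReal'`);
  `isUnramifiedIn_iff_exists_isReal`, `not_isUnramifiedIn_iff_exists_isComplex`;
* §2 hence **`isTypeOne_iff_not_isUnramifiedIn : IsTypeOne F E v ↔ ¬ v.1.IsUnramifiedIn E`** (choice-free), `isTypeOne_iff_forall_isComplex`,
  `not_isTypeOne_iff_forall_isReal`; above a type-(i) place `placeAbove F E v` is THE place (`eq_placeAbove_of_isTypeOne`,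
  `eq_placeAboveOne`); above a type-(ii) place the two places are `placeAboveTwo k` and `c • placeAboveTwo k ≠ placeAboveTwo k`
  (`smul_placeAboveTwo_ne`, `eq_or_eq_smul_placeAboveTwo`, `isReal_smul_placeAboveTwo`, `smul_placeAboveTwo_comap`);
* §3 the index equivalence **`realPlacesEquiv : {v // v.IsReal} ≃ {v // IsTypeOne F E v} ⊕ {v // ¬ IsTypeOne F E v}`**
  (`Equiv.sumCompl`), for re-indexing place-by-place products over the real places of `F` by type;
* §4 **`isEmpty_not_isTypeOne_iff : IsEmpty {v // ¬ IsTypeOne F E v} ↔ IsTotallyComplex E`** — `E` is totally complex iff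
  `F` has no type-(ii) real place — and, for `E` totally complex, `placeAboveOne = placeOverReal`,
  `placeAboveComplex = placeOverComplex` (`QuadExtTotallyComplexPlaces`; the same choice, `rfl`).

[PlatonovRapinchuk1994, §2.3 (archimedean places in quadratic extensions)]; [CasselsFrohlichANT1967, Ch. II §14].
Written for the stage-1 cell `pub-hodgecm` (GR lane, general-`(F, E, σ)` programme: the three-block archimedean Weil section
`Weil1964.ArchUnitaryWeilHalf3` is indexed by `p := IsTypeOne F E`); nothing here is a claim of the manuscripts adjudicated
by that cell.

## References
* [PlatonovRapinchuk1994] V. Platonov, A. Rapinchuk, *Algebraic Groups and Number Theory* (1994), §2.3.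
* [CasselsFrohlichANT1967] J. W. S. Cassels, A. Fröhlich (eds.), *Algebraic Number Theory* (1967), Ch. II §14.
-/

set_option autoImplicit false

noncomputable section

open scoped Classical
open NumberField NumberField.InfinitePlace

namespace Literature.NumberTheory.Automorphic

namespace UnitaryGroup

variable (F : Type) [Field F] [NumberField F] (E : Type) [Field E] [NumberField E] [Algebra F E]
  [Algebra.IsQuadraticExtension F E] (c : E ≃ₐ[F] E)

/-! ## §1 The dichotomy at a real place of `F` (intrinsic form) -/

section Dichotomy

variable {F E}

/-- every place of `E` above `v` is a Galois translate of any given one: the fibre of `w` is `{w, c • w}`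
(transitivity of `Gal(E/F) = {1, c}` on the fibre). [cite: PlatonovRapinchuk1994, §2.3] -/
theorem eq_or_eq_smul_of_comap_eq (hc : c ≠ 1) {w w' : InfinitePlace E}
    (h : w'.comap (algebraMap F E) = w.comap (algebraMap F E)) : w' = w ∨ w' = c • w := by
  haveI : IsGalois F E := Algebra.IsQuadraticExtension.isGalois F E
  obtain ⟨σ, rfl⟩ := exists_smul_eq_of_comap_eq h.symm
  have hσ : σ = 1 ∨ σ = c := by
    by_contra hne
    have h1 : σ ≠ 1 := fun h => hne (Or.inl h)
    have h2 : σ ≠ c := fun h => hne (Or.inr h)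
    haveI := Fintype.ofFinite (E ≃ₐ[F] E)
    have h3 : 3 ≤ Nat.card (E ≃ₐ[F] E) := by
      rw [Nat.card_eq_fintype_card]
      calc 3 = ({1, c, σ} : Finset (E ≃ₐ[F] E)).card := by
            rw [Finset.card_insert_of_notMem, Finset.card_pair h2.symm]
            simp only [Finset.mem_insert, Finset.mem_singleton, not_or]
            exact ⟨fun h => hc h.symm, fun h => h1 h.symm⟩
        _ ≤ _ := Finset.card_le_univ _
    rw [card_gal_eq_two F E] at h3
    omega
  rcases hσ with rfl | rfl
  · exact Or.inl (one_smul _ _)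
  · exact Or.inr rfl

omit [NumberField E] in
/-- **ramified ⇒ complex**: if the place `v` of `F` is not unramified in `E`, EVERY place of `E` above `v` is complex.
[cite: PlatonovRapinchuk1994, §2.3] -/
theorem isComplex_of_comap_eq_of_not_isUnramifiedIn {v : InfinitePlace F} (hv : ¬ v.IsUnramifiedIn E)
    {w : InfinitePlace E} (hw : w.comap (algebraMap F E) = v) : w.IsComplex := by
  haveI : IsGalois F E := Algebra.IsQuadraticExtension.isGalois F E
  subst hw
  rw [isUnramifiedIn_comap] at hv
  exact (not_isUnramified_iff.1 hv).1

omit [NumberField E] in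
/-- a place of `F` that is not unramified in `E` is real. [cite: PlatonovRapinchuk1994, §2.3] -/
theorem isReal_of_not_isUnramifiedIn {v : InfinitePlace F} (hv : ¬ v.IsUnramifiedIn E) : v.IsReal := by
  haveI : IsGalois F E := Algebra.IsQuadraticExtension.isGalois F E
  haveI : FiniteDimensional F E := Module.finite_of_finrank_eq_succ (Algebra.IsQuadraticExtension.finrank_eq_two F E)
  obtain ⟨w, rfl⟩ := comap_surjective (K := E) v
  rw [isUnramifiedIn_comap] at hv
  exact (not_isUnramified_iff.1 hv).2

/-- **ramified ⇒ one place**: above a place of `F` not unramified in `E` there is exactly one place of `E` (it is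
`c`-fixed, `smul_eq_of_isComplex_of_isReal_comap`). [cite: PlatonovRapinchuk1994, §2.3] -/
theorem eq_of_comap_eq_of_not_isUnramifiedIn (hc : c ≠ 1) {v : InfinitePlace F} (hv : ¬ v.IsUnramifiedIn E)
    {w w' : InfinitePlace E} (hw : w.comap (algebraMap F E) = v) (hw' : w'.comap (algebraMap F E) = v) : w' = w := by
  rcases eq_or_eq_smul_of_comap_eq c hc (hw'.trans hw.symm) with h | h
  · exact h
  · rw [h]
    exact smul_eq_of_isComplex_of_isReal_comap F E c w (isComplex_of_comap_eq_of_not_isUnramifiedIn hv hw)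
      (hw.symm ▸ isReal_of_not_isUnramifiedIn hv)

omit [NumberField F] [NumberField E] [Algebra.IsQuadraticExtension F E] in
/-- **unramified real ⇒ real**: if the real place `v` of `F` is unramified in `E`, EVERY place of `E` above `v` is real.
[cite: PlatonovRapinchuk1994, §2.3] -/
theorem isReal_of_comap_eq_of_isUnramifiedIn {v : InfinitePlace F} (hvr : v.IsReal) (hv : v.IsUnramifiedIn E)
    {w : InfinitePlace E} (hw : w.comap (algebraMap F E) = v) : w.IsReal :=
  (isUnramified_iff.1 (hv w hw)).resolve_right (by rw [hw]; exact not_isComplex_iff_isReal.2 hvr)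

omit [NumberField F] [NumberField E] [Algebra.IsQuadraticExtension F E] in
/-- a real place of `E` is moved by the involution: `c • w ≠ w` (its stabiliser is trivial, `w` being unramified).
[cite: PlatonovRapinchuk1994, §2.3] -/
theorem smul_ne_of_isReal' (hc : c ≠ 1) {w : InfinitePlace E} (hw : w.IsReal) : c • w ≠ w := by
  intro h
  have hmem : c ∈ MulAction.stabilizer (E ≃ₐ[F] E) w := MulAction.mem_stabilizer_iff.2 h
  rw [(IsReal.isUnramified (k := F) hw).stabilizer_eq_bot, Subgroup.mem_bot] at hmem
  exact hc hmem

omit [NumberField F] [NumberField E] [Algebra.IsQuadraticExtension F E] in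
/-- a real place `v` of `F` is unramified in `E` iff every place above it is real. [cite: PlatonovRapinchuk1994, §2.3] -/
theorem isUnramifiedIn_iff_forall_isReal {v : InfinitePlace F} (hvr : v.IsReal) :
    v.IsUnramifiedIn E ↔ ∀ w : InfinitePlace E, w.comap (algebraMap F E) = v → w.IsReal :=
  ⟨fun hv _ hw => isReal_of_comap_eq_of_isUnramifiedIn hvr hv hw, fun h w hw => IsReal.isUnramified F (h w hw)⟩

/-- … iff SOME place above it is real. [cite: PlatonovRapinchuk1994, §2.3] -/
theorem isUnramifiedIn_iff_exists_isReal {v : InfinitePlace F} (hvr : v.IsReal) :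
    v.IsUnramifiedIn E ↔ ∃ w : InfinitePlace E, w.comap (algebraMap F E) = v ∧ w.IsReal := by
  refine ⟨fun hv => ⟨placeAbove F E v, placeAbove_comap F E v,
    isReal_of_comap_eq_of_isUnramifiedIn hvr hv (placeAbove_comap F E v)⟩, fun ⟨w, hw, hwr⟩ => ?_⟩
  by_contra hv
  exact not_isComplex_iff_isReal.2 hwr (isComplex_of_comap_eq_of_not_isUnramifiedIn hv hw)

/-- a real place `v` is NOT unramified in `E` iff some — equivalently (`isComplex_of_comap_eq_of_not_isUnramifiedIn`) every —
place above it is complex. [cite: PlatonovRapinchuk1994, §2.3] -/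
theorem not_isUnramifiedIn_iff_exists_isComplex {v : InfinitePlace F} (hvr : v.IsReal) :
    ¬ v.IsUnramifiedIn E ↔ ∃ w : InfinitePlace E, w.comap (algebraMap F E) = v ∧ w.IsComplex := by
  refine ⟨fun hv => ⟨placeAbove F E v, placeAbove_comap F E v,
    isComplex_of_comap_eq_of_not_isUnramifiedIn hv (placeAbove_comap F E v)⟩, fun ⟨w, hw, hwc⟩ hv => ?_⟩
  exact not_isReal_iff_isComplex.2 hwc (isReal_of_comap_eq_of_isUnramifiedIn hvr hv hw)

/-- a real place of `E` lies above a real place of `F` that is unramified in `E`. [cite: PlatonovRapinchuk1994, §2.3] -/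
theorem isUnramifiedIn_comap_of_isReal {w : InfinitePlace E} (hw : w.IsReal) :
    (w.comap (algebraMap F E)).IsUnramifiedIn E :=
  (isUnramifiedIn_iff_exists_isReal (hw.comap _)).2 ⟨w, rfl, hw⟩

end Dichotomy

/-! ## §2 The types of `QuadExtPlacesAbove` are intrinsic; the fibres above type-(i) and type-(ii) places -/

/-- the conjugate of the chosen place also lies above `v`. [cite: CasselsFrohlichANT1967, Ch. II §14] -/
@[simp] theorem smul_placeAbove_comap (v : InfinitePlace F) : (c • placeAbove F E v).comap (algebraMap F E) = v := by
  rw [comap_smul, ← AlgEquiv.toAlgHom_toRingHom, AlgHom.comp_algebraMap]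
  exact placeAbove_comap F E v

/-- **type (i) is intrinsic**: `IsTypeOne F E v ↔ v` is not unramified in `E` (independent of the chosen place).
[cite: PlatonovRapinchuk1994, §2.3] -/
theorem isTypeOne_iff_not_isUnramifiedIn (v : {v : InfinitePlace F // v.IsReal}) :
    IsTypeOne F E v ↔ ¬ v.1.IsUnramifiedIn E :=
  ⟨fun h => (not_isUnramifiedIn_iff_exists_isComplex v.2).2 ⟨_, placeAbove_comap F E v.1, h⟩,
    fun h => isComplex_of_comap_eq_of_not_isUnramifiedIn h (placeAbove_comap F E v.1)⟩

/-- **type (ii) is intrinsic**: `¬ IsTypeOne F E v ↔ v` is unramified in `E`. [cite: PlatonovRapinchuk1994, §2.3] -/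
theorem not_isTypeOne_iff_isUnramifiedIn (v : {v : InfinitePlace F // v.IsReal}) :
    ¬ IsTypeOne F E v ↔ v.1.IsUnramifiedIn E := by
  rw [isTypeOne_iff_not_isUnramifiedIn, not_not]

/-- type (i) iff EVERY place above `v` is complex. [cite: PlatonovRapinchuk1994, §2.3] -/
theorem isTypeOne_iff_forall_isComplex (v : {v : InfinitePlace F // v.IsReal}) :
    IsTypeOne F E v ↔ ∀ w : InfinitePlace E, w.comap (algebraMap F E) = v.1 → w.IsComplex :=
  ⟨fun h _ hw => isComplex_of_comap_eq_of_not_isUnramifiedIn ((isTypeOne_iff_not_isUnramifiedIn F E v).1 h) hw,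
    fun h => h _ (placeAbove_comap F E v.1)⟩

/-- type (ii) iff EVERY place above `v` is real. [cite: PlatonovRapinchuk1994, §2.3] -/
theorem not_isTypeOne_iff_forall_isReal (v : {v : InfinitePlace F // v.IsReal}) :
    ¬ IsTypeOne F E v ↔ ∀ w : InfinitePlace E, w.comap (algebraMap F E) = v.1 → w.IsReal := by
  rw [not_isTypeOne_iff_isUnramifiedIn]
  exact isUnramifiedIn_iff_forall_isReal v.2

/-- **above a type-(i) place, `placeAbove F E v` is THE place.** [cite: PlatonovRapinchuk1994, §2.3] -/
theorem eq_placeAbove_of_isTypeOne (hc : c ≠ 1) {v : {v : InfinitePlace F // v.IsReal}} (hv : IsTypeOne F E v)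
    (w : InfinitePlace E) (hw : w.comap (algebraMap F E) = v.1) : w = placeAbove F E v.1 :=
  eq_of_comap_eq_of_not_isUnramifiedIn c hc ((isTypeOne_iff_not_isUnramifiedIn F E v).1 hv) (placeAbove_comap F E v.1) hw

/-- (typed form) above a type-(i) place, `placeAboveOne F E k` is the only place. [cite: PlatonovRapinchuk1994, §2.3] -/
theorem eq_placeAboveOne (hc : c ≠ 1) (k : {v : {v : InfinitePlace F // v.IsReal} // IsTypeOne F E v})
    (w : InfinitePlace E) (hw : w.comap (algebraMap F E) = k.1.1) : w = (placeAboveOne F E k).1 :=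
  eq_placeAbove_of_isTypeOne F E c hc k.2 w hw

/-- the fibre above ANY archimedean place `v` of `F` is `{placeAbove F E v, c • placeAbove F E v}`.
[cite: PlatonovRapinchuk1994, §2.3] -/
theorem eq_or_eq_smul_placeAbove (hc : c ≠ 1) {v : InfinitePlace F} (w : InfinitePlace E)
    (hw : w.comap (algebraMap F E) = v) : w = placeAbove F E v ∨ w = c • placeAbove F E v :=
  eq_or_eq_smul_of_comap_eq c hc (hw.trans (placeAbove_comap F E v).symm)

/-- **above a type-(ii) place the two places are distinct**: `c • placeAboveTwo k ≠ placeAboveTwo k`.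
[cite: PlatonovRapinchuk1994, §2.3] -/
theorem smul_placeAboveTwo_ne (hc : c ≠ 1) (k : {v : {v : InfinitePlace F // v.IsReal} // ¬ IsTypeOne F E v}) :
    c • (placeAboveTwo F E k).1 ≠ (placeAboveTwo F E k).1 :=
  smul_ne_of_isReal' c hc (placeAboveTwo F E k).2

/-- the conjugate `c • placeAboveTwo k` is real. [cite: PlatonovRapinchuk1994, §2.3] -/
theorem isReal_smul_placeAboveTwo (k : {v : {v : InfinitePlace F // v.IsReal} // ¬ IsTypeOne F E v}) :
    (c • (placeAboveTwo F E k).1).IsReal :=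
  isReal_smul_iff.2 (placeAboveTwo F E k).2

/-- … and lies above `v`. [cite: CasselsFrohlichANT1967, Ch. II §14] -/
@[simp] theorem smul_placeAboveTwo_comap (k : {v : {v : InfinitePlace F // v.IsReal} // ¬ IsTypeOne F E v}) :
    (c • (placeAboveTwo F E k).1).comap (algebraMap F E) = k.1.1 :=
  smul_placeAbove_comap F E c k.1.1

/-- **the fibre above a type-(ii) place is `{placeAboveTwo k, c • placeAboveTwo k}`.** [cite: PlatonovRapinchuk1994, §2.3] -/
theorem eq_or_eq_smul_placeAboveTwo (hc : c ≠ 1) (k : {v : {v : InfinitePlace F // v.IsReal} // ¬ IsTypeOne F E v})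
    (w : InfinitePlace E) (hw : w.comap (algebraMap F E) = k.1.1) :
    w = (placeAboveTwo F E k).1 ∨ w = c • (placeAboveTwo F E k).1 :=
  eq_or_eq_smul_placeAbove F E c hc w hw

/-- a real place `w` of `E` lies above a type-(ii) place of `F`. [cite: PlatonovRapinchuk1994, §2.3] -/
theorem not_isTypeOne_comap_of_isReal {w : InfinitePlace E} (hw : w.IsReal) :
    ¬ IsTypeOne F E ⟨w.comap (algebraMap F E), hw.comap _⟩ :=
  (not_isTypeOne_iff_isUnramifiedIn F E _).2 (isUnramifiedIn_comap_of_isReal hw)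

/-! ## §3 Re-indexing the real places of `F` by type -/

/-- **`{v // v.IsReal} ≃ {v // IsTypeOne F E v} ⊕ {v // ¬ IsTypeOne F E v}`**: every real place of `F` is of exactly one
type (`Equiv.sumCompl`). [cite: PlatonovRapinchuk1994, §2.3] -/
def realPlacesEquiv : {v : InfinitePlace F // v.IsReal} ≃
    {v : {v : InfinitePlace F // v.IsReal} // IsTypeOne F E v} ⊕ {v : {v : InfinitePlace F // v.IsReal} // ¬ IsTypeOne F E v} :=
  (Equiv.sumCompl (IsTypeOne F E)).symm

/-- `realPlacesEquiv` on a type-(i) place. [cite: PlatonovRapinchuk1994, §2.3] -/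
@[simp] theorem realPlacesEquiv_apply_of_isTypeOne (v : {v : InfinitePlace F // v.IsReal}) (hv : IsTypeOne F E v) :
    realPlacesEquiv F E v = Sum.inl ⟨v, hv⟩ :=
  Equiv.sumCompl_symm_apply_of_pos (p := IsTypeOne F E) hv

/-- `realPlacesEquiv` on a type-(ii) place. [cite: PlatonovRapinchuk1994, §2.3] -/
@[simp] theorem realPlacesEquiv_apply_of_not_isTypeOne (v : {v : InfinitePlace F // v.IsReal}) (hv : ¬ IsTypeOne F E v) :
    realPlacesEquiv F E v = Sum.inr ⟨v, hv⟩ :=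
  Equiv.sumCompl_symm_apply_of_neg (p := IsTypeOne F E) hv

/-- the inverse of `realPlacesEquiv` is the structure map on the type-(i) summand. [cite: PlatonovRapinchuk1994, §2.3] -/
@[simp] theorem realPlacesEquiv_symm_inl (k : {v : {v : InfinitePlace F // v.IsReal} // IsTypeOne F E v}) :
    (realPlacesEquiv F E).symm (Sum.inl k) = k.1 := rfl

/-- the inverse of `realPlacesEquiv` is the structure map on the type-(ii) summand. [cite: PlatonovRapinchuk1994, §2.3] -/
@[simp] theorem realPlacesEquiv_symm_inr (k : {v : {v : InfinitePlace F // v.IsReal} // ¬ IsTypeOne F E v}) :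
    (realPlacesEquiv F E).symm (Sum.inr k) = k.1 := rfl

/-! ## §4 The totally complex case: no type-(ii) places -/

/-- **`E` is totally complex iff `F` has no type-(ii) real place.** [cite: PlatonovRapinchuk1994, §2.3] -/
theorem isEmpty_not_isTypeOne_iff :
    IsEmpty {v : {v : InfinitePlace F // v.IsReal} // ¬ IsTypeOne F E v} ↔ IsTotallyComplex E := by
  refine ⟨fun h => ⟨fun w => ?_⟩, fun h => ⟨fun k => k.2 (@isTypeOne_of_isTotallyComplex F _ _ E _ _ _ _ h k.1)⟩⟩
  by_contra hw
  have hwr := not_isComplex_iff_isReal.1 hw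
  exact h.elim ⟨⟨w.comap (algebraMap F E), hwr.comap _⟩, not_isTypeOne_comap_of_isReal F E hwr⟩

/-- for `E` totally complex there is no type-(ii) real place (instance form). [cite: PlatonovRapinchuk1994, §2.3] -/
instance isEmpty_not_isTypeOne [IsTotallyComplex E] :
    IsEmpty {v : {v : InfinitePlace F // v.IsReal} // ¬ IsTypeOne F E v} :=
  (isEmpty_not_isTypeOne_iff F E).2 inferInstance

/-- for `E` totally complex, `placeAbove` underlies the tree's `placeOverReal` (same choice).
[cite: CasselsFrohlichANT1967, Ch. II §14] -/
theorem coe_placeOverReal_eq_placeAbove [IsTotallyComplex E] (v : {v : InfinitePlace F // v.IsReal}) :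
    (placeOverReal F E v).1 = placeAbove F E v.1 := rfl

/-- for `E` totally complex, `placeAboveOne k = placeOverReal k.1` (same choice). [cite: CasselsFrohlichANT1967, Ch. II §14] -/
theorem placeAboveOne_eq_placeOverReal [IsTotallyComplex E] (k : {v : {v : InfinitePlace F // v.IsReal} // IsTypeOne F E v}) :
    placeAboveOne F E k = placeOverReal F E k.1 := rfl

/-- for `E` totally complex, `placeAboveComplex = placeOverComplex` (same choice). [cite: CasselsFrohlichANT1967, Ch. II §14] -/
theorem placeAboveComplex_eq_placeOverComplex [IsTotallyComplex E] (v : {v : InfinitePlace F // v.IsComplex}) :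
    placeAboveComplex F E v = placeOverComplex F E v := rfl

end UnitaryGroup

end Literature.NumberTheory.Automorphic

end
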